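import Literature.Probability.RandomPlanarGeometry.HexSAWSurfaceWallRenewalNinthCensusIdentity
import Literature.Probability.RandomPlanarGeometry.HexSAWSurfaceWallRenewalCensusNineB
import HarnessLib

/-!
# The tenth-order census identity of the adsorbed honeycomb walk:
# `y⁹ (β(y)² − y − 1/y − 1/y² − 2/y³ − 4/y⁴ − 6/y⁵ − 12/y⁶ − 18/y⁷ − 15/y⁸) → N₁₁,₁ + N₁₂,₂ + N₁₃,₃ + N₁₄,₄ + N₁₅,₅ − 2155`

`β(y) = wallRate y` is the exponential growth rate of wall bridges of self-avoiding walks on the brick-wall (hexagonal) lattice along a zigzag wall with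
contact fugacity `y`; `N_{s,v} = #{ω ∈ ipwb (2s) : visits = v}` are the class numbers of the wall-renewal census.  With «CENSUS-NINE-A/B» (this lineage; the
counting engine «CENSUS-ENGINE») the diagonal `s − v = 9` is complete (`267 / 295 / 132 / 16`) and «A8-EXACT» gives `β² = y + 1/y + 1/y² + 2/y³ + 4/y⁴ + 6/y⁵ +
12/y⁶ + 18/y⁷ + 15/y⁸ + o(y⁻⁸)`.  This module is «NINTH-CENSUS-IDENTITY» ONE ORDER UP: the TENTH coefficient EXISTS and is identified with the diagonal
`s − v = 10`, its five class numbers kept SYMBOLIC (`hᵢ : mᵢ = 22, 24, 26, 28, 30`):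

  ★★★ `tendsto_pow_nine_mul_wallRate_sq_sub_census : y⁹ (β² − y − … − 18/y⁷ − 15/y⁸) → N₁₁,₁ + N₁₂,₂ + N₁₃,₃ + N₁₄,₄ + N₁₅,₅ − 2155`.

The data (this seat's engine replica and FIRST-A a-ref-2 g58's independent enumerator, 2026-08-27): `738 / 860 / 468 / 95 / 1` (sum `2162`) ⇒ `a₉ = 7`; `N₁₁,₁ = 738` is already a
tree theorem («CENSUS-NINE-B»), `N₁₅,₅ = 1` is «SIX-STEP-RIGIDITY» at `n = 30`; the other three are the successor car «CENSUS-TEN».  The subtracted `15/y⁸` is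
used only through the statement: the proof needs the coefficients through `a₇ = 18` (eighth tower rung `M`).

METHOD (the template once more).  (§1) the eighth rung `M = y⁸(1 − r) − y⁶ − y⁵ − y⁴ − 2y³ − 2y² − 3y → 2` (from `a₇ = 18`, «A7-EXACT», by `M = D₇·r − K − H − 2P − 4Q − 6A − 12A/y`),
`visits ≤ 5` for `n ≤ 35` (six-step law) and the class bounds at `n = 22, …, 32` (diagonal `≤ 9` exact: `295, 33 / 132, 1 / 16`; diagonal `10` symbolic; the rest crude `3ⁿ`).
(§2) the order-ten head sandwich on `y > μ³` with the tail at `n = 16` (`θ₃^{16} ≍ y^{−32/3} = o(y⁻¹⁰)`) and `CRUDE₁₀ = O(y⁻¹¹)`.  (§3) `y⁹β²·tail → 0`.  (§4) the exact identity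
`T − G = y⁹β²(1 − H₁₀)`.  (§5) `G → ΣN − 2155` by a 56-monomial identity in the tower `A, Q, P, H, K, L, M` and `u = 1/y`.  (§6) squeeze.

HONEST LABEL.  LANE THEOREM for this model, DERIVED; NEW IN WRITING (modest): the identity and the constant `2155` are computed in this lane (exact rationals:
`HOME/pub-sawmu-a-p6/g21/tenth/tower10.py`; FIRST-A's independent formal-series inversion gives the same `a₉ = 7` and predicts `a₁₀ = −16`).  Print: `β ∼ √y`
([BeatonBousquetMelouDeGierDuminilCopinGuttmann2014, §3.1, Proposition 5 and p. 10 (arXiv v5)]), renewal theory ([MadrasSlade1993, §4.2], [Kesten1963SAW, §4]).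
NOT CLAIMED: the five class numbers, hence not `a₉ = 7`; anything for `y ≤ μ³`.  No definitions.  Budget lines: 1 (`set_option maxHeartbeats 400000 in` before the
closed-form identity `tenth_order_two_sided_of_cube_lt`).
-/

noncomputable section

namespace Literature.Probability.RandomPlanarGeometry.SAW.HexBW.Wall

open Finset Filter Function
open Literature.Probability.LatticeModels
open _root_.Topology Asymptotics

variable {y : ℝ} {n : ℕ} {ω : ℕ → Site 2}

/-! ### §0  Private helpers -/

/-- [folklore] Relabel the limit of a `Tendsto` by an equal constant. -/
private theorem tendsto_of_tendsto_of_eq_ti {f : ℝ → ℝ} {L c : ℝ} (h : Tendsto f atTop (𝓝 L)) (e : L = c) :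
    Tendsto f atTop (𝓝 c) := e ▸ h

/-- [folklore] `f₁(y) ≤ y/β(y)²` (`f₁ ≤ u₁ ≤ 1` would not do; the class `(1,1)` is the straight walk, so `Λ₂ ≤ y`: copied from
«KESTEN-HEAD-SEVEN»'s private `pwbLaw_one_le_div_khs` via `IPWB ≤ PWB ≤ y` on `pwb 2 = {straight}`). [cite: MadrasSlade1993, §4.2, Theorem 4.2.2(b) (pp. 91–92)] -/
private theorem pwbLaw_one_le_div_ti (hy : 0 ≤ y) : pwbLaw y 1 ≤ y / wallRate y ^ 2 := by
  classical
  -- `pwb 2 ⊆ {straightWalk 2 2}` exactly as in «KESTEN-HEAD-SEVEN»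
  have hsub : pwb 2 ⊆ {Zd.straightWalk 2 2} := by
    intro ω hω
    rw [Finset.mem_singleton]
    obtain ⟨hwbr, hbr⟩ := mem_pwb.1 hω
    obtain ⟨harch, -⟩ := mem_wbr.1 hwbr
    obtain ⟨hhpw, -, h21⟩ := mem_archs.1 harch
    obtain ⟨hsaw, -⟩ := mem_hpw.1 hhpw
    obtain ⟨h0, hend, hbw, -⟩ := mem_saws_iff.1 hsaw
    have h00 : ω 0 0 = 0 := by simp [h0]
    have h01 : ω 0 1 = 0 := by simp [h0]
    have hs0 : brickWallGraph.Adj (ω 0) (ω 1) := hbw 0 (by norm_num)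
    have hs1 : brickWallGraph.Adj (ω 1) (ω 2) := hbw 1 (by norm_num)
    rw [brickWallGraph_adj_coord] at hs0 hs1
    have hb1 : ω 0 0 < ω 1 0 ∧ ω 1 0 ≤ ω 2 0 := hbr 1 le_rfl (by norm_num)
    have h10 : ω 1 0 = 1 := by omega
    have h11 : ω 1 1 = 0 := by omega
    have h20 : ω 2 0 = 2 := by omega
    funext i
    have hX : ω i 0 = ((min i 2 : ℕ) : ℤ) := by
      rcases Nat.lt_or_ge i 2 with hi | hi
      · interval_cases i
        · simp [h00]
        · simp [h10]
      · rw [hend i hi, min_eq_right hi, h20]; norm_num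
    have hY : ω i 1 = 0 := by
      rcases Nat.lt_or_ge i 2 with hi | hi
      · interval_cases i
        · exact h01
        · exact h11
      · rw [hend i hi, h21]
    funext j
    fin_cases j
    · simpa [straightWalk_apply_zero] using hX
    · simpa [straightWalk_apply_one] using hY
  have hv : visits 2 (Zd.straightWalk 2 2) = 1 := (straightWalk_mem_pwb 1).2
  have hP : PWB 2 y ≤ y := by
    unfold PWB
    calc ∑ ω ∈ pwb 2, y ^ visits 2 ω ≤ ∑ ω ∈ ({Zd.straightWalk 2 2} : Finset (ℕ → Site 2)), y ^ visits 2 ω :=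
          Finset.sum_le_sum_of_subset_of_nonneg hsub (fun _ _ _ => pow_nonneg hy _)
      _ = y := by rw [Finset.sum_singleton, hv, pow_one]
  show IPWB 2 y / wallRate y ^ 2 ≤ y / wallRate y ^ 2
  exact div_le_div_of_nonneg_right ((IPWB_le_PWB 2 hy).trans hP) (pow_pos (wallRate_pos y) 2).le

/-- [folklore] A class count is at most `3^n`: `#((ipwb n).filter p) ≤ 3^n`. [cite: MadrasSlade1993, §1.2, (1.2.16) (p. 11)] -/
private theorem card_filter_ipwb_le_ti (n : ℕ) (p : (ℕ → Site 2) → Prop) [DecidablePred p] :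
    (#((ipwb n).filter p) : ℝ) ≤ 3 ^ n :=
  le_trans (by exact_mod_cast Finset.card_filter_le _ _) (card_ipwb_le_three_pow n)

/-- [folklore] `f_k(y) = Λ_{2k}(y)/β(y)^{2k}` with the length as a numeral. [cite: MadrasSlade1993, §4.2, (4.2.2)] -/
private theorem pwbLaw_eq_ti (k : ℕ) {m : ℕ} (hm : m = 2 * k) : pwbLaw y k = IPWB m y / wallRate y ^ m := by
  rw [pwbLaw, hm]

/-- `y/β² → 1`. [cite: BeatonBousquetMelouDeGierDuminilCopinGuttmann2014, Section 3.1, Proposition 5 (arXiv v5 p. 9)] -/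
private theorem tendsto_div_sq_wallRate_ti : Tendsto (fun y : ℝ => y / wallRate y ^ 2) atTop (𝓝 1) := by
  have h1 : Tendsto (fun y : ℝ => ((wallRate y / Real.sqrt y) ^ 2)⁻¹) atTop (𝓝 ((1 : ℝ) ^ 2)⁻¹) :=
    (tendsto_wallRate_div_sqrt.pow 2).inv₀ (by norm_num)
  rw [one_pow, inv_one] at h1
  refine h1.congr' ?_
  filter_upwards [eventually_gt_atTop (0 : ℝ)] with y hy
  rw [div_pow, Real.sq_sqrt hy.le, inv_div]

/-- `β²/y → 1`. [cite: BeatonBousquetMelouDeGierDuminilCopinGuttmann2014, Section 3.1, Proposition 5 (arXiv v5 p. 9)] -/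
private theorem tendsto_sq_wallRate_div_ti : Tendsto (fun y : ℝ => wallRate y ^ 2 / y) atTop (𝓝 1) := by
  have h1 : Tendsto (fun y : ℝ => (wallRate y / Real.sqrt y) ^ 2) atTop (𝓝 ((1 : ℝ) ^ 2)) := tendsto_wallRate_div_sqrt.pow 2
  rw [one_pow] at h1
  refine h1.congr' ?_
  filter_upwards [eventually_gt_atTop (0 : ℝ)] with y hy
  rw [div_pow, Real.sq_sqrt hy.le]

/-- [folklore] Exponent bookkeeping: `(y^{2/3})^{16} = y¹⁰ · y^{2/3}` for `y > 0`. -/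
private theorem rpow_two_thirds_pow_sixteen_ti (hy : 0 < y) : (y ^ ((2 : ℝ) / 3)) ^ 16 = y ^ 10 * y ^ ((2 : ℝ) / 3) := by
  rw [← Real.rpow_natCast (y ^ ((2 : ℝ) / 3)) 16, ← Real.rpow_mul hy.le, ← Real.rpow_natCast y 10, ← Real.rpow_add hy]
  norm_num

/-! ### §1  The eighth rung of the `β²`-tower, `visits ≤ 5`, and the class bounds at `n = 22, …, 32` -/

/-- ★ **`y⁸ (1 − y/β(y)²) − y⁶ − y⁵ − y⁴ − 2y³ − 2y² − 3y → 2`** — the eighth rung `M` of the `β²`-tower, from the eighth-order limit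
`y⁷(β² − y − 1/y − … − 12/y⁶) → 18` («A7-EXACT») by `M = D₇·r − K − H − 2P − 4Q − 6A − 12A/y`.
[cite: BeatonBousquetMelouDeGierDuminilCopinGuttmann2014, Section 3.1, Proposition 5 (arXiv v5 p. 9) and p. 10] -/
theorem tendsto_pow_eight_mul_one_sub_div_sub :
    Tendsto (fun y : ℝ => y ^ 8 * (1 - y / wallRate y ^ 2) - y ^ 6 - y ^ 5 - y ^ 4 - 2 * y ^ 3 - 2 * y ^ 2 - 3 * y) atTop (𝓝 2) := by
  have hr := tendsto_div_wallRate_sq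
  have hA := tendsto_sq_mul_one_sub_div_wallRate_sq
  have hQ := tendsto_cube_mul_one_sub_div_sub
  have hP := tendsto_pow_four_mul_one_sub_div_sub
  have hH := tendsto_pow_five_mul_one_sub_div_sub
  have hK := tendsto_pow_six_mul_one_sub_div_sub
  have hD := tendsto_pow_seven_mul_wallRate_sq_sub
  have hu : Tendsto (fun y : ℝ => y⁻¹) atTop (𝓝 0) := tendsto_inv_atTop_zero
  have h := ((((((hD.mul hr).sub hK).sub hH).sub (hP.const_mul 2)).sub (hQ.const_mul 4)).sub (hA.const_mul 6)).sub ((hA.mul hu).const_mul 12)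
  refine Tendsto.congr' ?_ (tendsto_of_tendsto_of_eq_ti h (by norm_num))
  filter_upwards [eventually_gt_atTop (0 : ℝ)] with y hy
  have hw : wallRate y ≠ 0 := (wallRate_pos y).ne'
  have hy' : y ≠ 0 := hy.ne'
  field_simp
  ring

/-- Blocks of length `n ∈ [4, 35]` visit the surface at most five times (six-step law `6·visits ≤ n`, car 71). [cite: MadrasSlade1993, Section 4.2, remark before (4.2.21) (p. 94)] -/
theorem visits_le_five_of_le_thirtyfive (h4 : 4 ≤ n) (h35 : n ≤ 35) (hω : ω ∈ ipwb n) : visits n ω ≤ 5 := by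
  have := six_mul_visits_le hω h4
  omega

open Classical in
/-- ★ `Λ₂₂(y) = N₁₁,₁·y + 295y² + 33y³` (`N₁₁,₂ = 295` «CENSUS-NINE-B», `N₁₁,₃ = 33` «CENSUS-EIGHT-B2»; `N₁₁,₁` kept symbolic). [cite: MadrasSlade1993, Section 4.2, (4.2.2) (p. 91)] -/
theorem IPWB_twentytwo_eq_census_ten {m : ℕ} (hm : m = 22) (y : ℝ) :
    IPWB m y = #((ipwb m).filter fun ω => visits m ω = 1) * y + 295 * y ^ 2 + 33 * y ^ 3 := by
  have e := IPWB_eq_sum_range_card_mul_pow (m := m) (V := 4) (fun ω hω => visits_le_four_of_le_twentynine (by omega) (by omega) hω) y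
  have h4 : #((ipwb m).filter fun ω => visits m ω = 4) = 0 :=
    Finset.card_eq_zero.2 (Finset.filter_eq_empty_iff.2 fun ω hω h4 => by have := six_mul_visits_le hω (by omega); omega)
  simp only [Finset.sum_range_succ, Finset.sum_range_zero, card_zeroVisit_ipwb_eq_zero, card_twoVisit_ipwb_twentytwo_eq hm,
    card_threeVisit_ipwb_twentytwo_eq_thirtyThree hm, h4] at e
  rw [e]; push_cast; ring

open Classical in
/-- ★ `Λ₂₄(y) = N₁₂,₁·y + N₁₂,₂·y² + 132y³ + y⁴` with `N₁₂,₁ ≤ 3²⁴`: for `y ≥ 0`, `N₁₂,₂y² + 132y³ + y⁴ ≤ Λ₂₄ ≤ 3²⁴y + N₁₂,₂y² + 132y³ + y⁴`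
(`N₁₂,₃ = 132` «CENSUS-NINE-B», `N₁₂,₄ = 1`). [cite: MadrasSlade1993, Section 4.2, (4.2.2); Section 1.2, (1.2.16) (p. 11)] -/
theorem IPWB_twentyfour_two_sided_ten {m : ℕ} (hm : m = 24) (hy : 0 ≤ y) :
    #((ipwb m).filter fun ω => visits m ω = 2) * y ^ 2 + 132 * y ^ 3 + y ^ 4 ≤ IPWB m y ∧
      IPWB m y ≤ 3 ^ 24 * y + #((ipwb m).filter fun ω => visits m ω = 2) * y ^ 2 + 132 * y ^ 3 + y ^ 4 := by
  have e := IPWB_eq_sum_range_card_mul_pow (m := m) (V := 4) (fun ω hω => visits_le_four_of_le_twentynine (by omega) (by omega) hω) y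
  simp only [Finset.sum_range_succ, Finset.sum_range_zero, card_zeroVisit_ipwb_eq_zero, card_threeVisit_ipwb_twentyfour_eq hm,
    card_fourVisit_ipwb_twentyfour_eq_one hm] at e
  have h3 : (3 : ℝ) ^ m = 3 ^ 24 := by rw [hm]
  have hN1 := mul_le_mul_of_nonneg_right (card_filter_ipwb_le_ti m (fun ω => visits m ω = 1)) hy
  have hN1' : (0 : ℝ) ≤ #((ipwb m).filter fun ω => visits m ω = 1) * y := mul_nonneg (Nat.cast_nonneg _) hy
  rw [h3] at hN1
  constructor
  · rw [e]; push_cast; linarith [hN1']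
  · rw [e]; push_cast; linarith [hN1]

open Classical in
/-- ★ `Λ₂₆(y) = N₁₃,₁·y + N₁₃,₂·y² + N₁₃,₃·y³ + 16y⁴` with `N₁₃,₁, N₁₃,₂ ≤ 3²⁶`: for `y ≥ 0`, `N₁₃,₃y³ + 16y⁴ ≤ Λ₂₆ ≤ 3²⁶(y + y²) + N₁₃,₃y³ + 16y⁴`
(`N₁₃,₄ = 16` «CENSUS-NINE-B»). [cite: MadrasSlade1993, Section 4.2, (4.2.2); Section 1.2, (1.2.16) (p. 11)] -/
theorem IPWB_twentysix_two_sided_ten {m : ℕ} (hm : m = 26) (hy : 0 ≤ y) :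
    #((ipwb m).filter fun ω => visits m ω = 3) * y ^ 3 + 16 * y ^ 4 ≤ IPWB m y ∧
      IPWB m y ≤ 3 ^ 26 * (y + y ^ 2) + #((ipwb m).filter fun ω => visits m ω = 3) * y ^ 3 + 16 * y ^ 4 := by
  have e := IPWB_eq_sum_range_card_mul_pow (m := m) (V := 4) (fun ω hω => visits_le_four_of_le_twentynine (by omega) (by omega) hω) y
  simp only [Finset.sum_range_succ, Finset.sum_range_zero, card_zeroVisit_ipwb_eq_zero, card_fourVisit_ipwb_twentysix_eq hm] at e
  have h3 : (3 : ℝ) ^ m = 3 ^ 26 := by rw [hm]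
  have hN1 := mul_le_mul_of_nonneg_right (card_filter_ipwb_le_ti m (fun ω => visits m ω = 1)) hy
  have hN2 := mul_le_mul_of_nonneg_right (card_filter_ipwb_le_ti m (fun ω => visits m ω = 2)) (pow_nonneg hy 2)
  have hN1' : (0 : ℝ) ≤ #((ipwb m).filter fun ω => visits m ω = 1) * y := mul_nonneg (Nat.cast_nonneg _) hy
  have hN2' : (0 : ℝ) ≤ #((ipwb m).filter fun ω => visits m ω = 2) * y ^ 2 := mul_nonneg (Nat.cast_nonneg _) (pow_nonneg hy 2)
  rw [h3] at hN1 hN2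
  constructor
  · rw [e]; push_cast; linarith [hN1', hN2']
  · rw [e]; push_cast; linarith [hN1, hN2]

open Classical in
/-- ★ `Λ₂₈(y) = Σ_{v ≤ 4} N₁₄,ᵥ·y^v` with `N₁₄,₁, N₁₄,₂, N₁₄,₃ ≤ 3²⁸`: for `y ≥ 0`, `N₁₄,₄y⁴ ≤ Λ₂₈ ≤ 3²⁸(y + y² + y³) + N₁₄,₄y⁴`. [cite: MadrasSlade1993, Section 4.2, (4.2.2); Section 1.2, (1.2.16) (p. 11)] -/
theorem IPWB_twentyeight_two_sided {m : ℕ} (hm : m = 28) (hy : 0 ≤ y) :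
    #((ipwb m).filter fun ω => visits m ω = 4) * y ^ 4 ≤ IPWB m y ∧
      IPWB m y ≤ 3 ^ 28 * (y + y ^ 2 + y ^ 3) + #((ipwb m).filter fun ω => visits m ω = 4) * y ^ 4 := by
  have e := IPWB_eq_sum_range_card_mul_pow (m := m) (V := 4) (fun ω hω => visits_le_four_of_le_twentynine (by omega) (by omega) hω) y
  simp only [Finset.sum_range_succ, Finset.sum_range_zero, card_zeroVisit_ipwb_eq_zero] at e
  have h3 : (3 : ℝ) ^ m = 3 ^ 28 := by rw [hm]
  have hN1 := mul_le_mul_of_nonneg_right (card_filter_ipwb_le_ti m (fun ω => visits m ω = 1)) hy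
  have hN2 := mul_le_mul_of_nonneg_right (card_filter_ipwb_le_ti m (fun ω => visits m ω = 2)) (pow_nonneg hy 2)
  have hN3 := mul_le_mul_of_nonneg_right (card_filter_ipwb_le_ti m (fun ω => visits m ω = 3)) (pow_nonneg hy 3)
  have hN1' : (0 : ℝ) ≤ #((ipwb m).filter fun ω => visits m ω = 1) * y := mul_nonneg (Nat.cast_nonneg _) hy
  have hN2' : (0 : ℝ) ≤ #((ipwb m).filter fun ω => visits m ω = 2) * y ^ 2 := mul_nonneg (Nat.cast_nonneg _) (pow_nonneg hy 2)
  have hN3' : (0 : ℝ) ≤ #((ipwb m).filter fun ω => visits m ω = 3) * y ^ 3 := mul_nonneg (Nat.cast_nonneg _) (pow_nonneg hy 3)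
  rw [h3] at hN1 hN2 hN3
  constructor
  · rw [e]; push_cast; linarith [hN1', hN2', hN3']
  · rw [e]; push_cast; linarith [hN1, hN2, hN3]

open Classical in
/-- ★ `Λ₃₀(y) = Σ_{v ≤ 5} N₁₅,ᵥ·y^v` with `N₁₅,₁, …, N₁₅,₄ ≤ 3³⁰`: for `y ≥ 0`, `N₁₅,₅y⁵ ≤ Λ₃₀ ≤ 3³⁰(y + y² + y³ + y⁴) + N₁₅,₅y⁵`. [cite: MadrasSlade1993, Section 4.2, (4.2.2); Section 1.2, (1.2.16) (p. 11)] -/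
theorem IPWB_thirty_two_sided {m : ℕ} (hm : m = 30) (hy : 0 ≤ y) :
    #((ipwb m).filter fun ω => visits m ω = 5) * y ^ 5 ≤ IPWB m y ∧
      IPWB m y ≤ 3 ^ 30 * (y + y ^ 2 + y ^ 3 + y ^ 4) + #((ipwb m).filter fun ω => visits m ω = 5) * y ^ 5 := by
  have e := IPWB_eq_sum_range_card_mul_pow (m := m) (V := 5) (fun ω hω => visits_le_five_of_le_thirtyfive (by omega) (by omega) hω) y
  simp only [Finset.sum_range_succ, Finset.sum_range_zero, card_zeroVisit_ipwb_eq_zero] at e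
  have h3 : (3 : ℝ) ^ m = 3 ^ 30 := by rw [hm]
  have hN1 := mul_le_mul_of_nonneg_right (card_filter_ipwb_le_ti m (fun ω => visits m ω = 1)) hy
  have hN2 := mul_le_mul_of_nonneg_right (card_filter_ipwb_le_ti m (fun ω => visits m ω = 2)) (pow_nonneg hy 2)
  have hN3 := mul_le_mul_of_nonneg_right (card_filter_ipwb_le_ti m (fun ω => visits m ω = 3)) (pow_nonneg hy 3)
  have hN4 := mul_le_mul_of_nonneg_right (card_filter_ipwb_le_ti m (fun ω => visits m ω = 4)) (pow_nonneg hy 4)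
  have hN1' : (0 : ℝ) ≤ #((ipwb m).filter fun ω => visits m ω = 1) * y := mul_nonneg (Nat.cast_nonneg _) hy
  have hN2' : (0 : ℝ) ≤ #((ipwb m).filter fun ω => visits m ω = 2) * y ^ 2 := mul_nonneg (Nat.cast_nonneg _) (pow_nonneg hy 2)
  have hN3' : (0 : ℝ) ≤ #((ipwb m).filter fun ω => visits m ω = 3) * y ^ 3 := mul_nonneg (Nat.cast_nonneg _) (pow_nonneg hy 3)
  have hN4' : (0 : ℝ) ≤ #((ipwb m).filter fun ω => visits m ω = 4) * y ^ 4 := mul_nonneg (Nat.cast_nonneg _) (pow_nonneg hy 4)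
  rw [h3] at hN1 hN2 hN3 hN4
  constructor
  · rw [e]; push_cast; linarith [hN1', hN2', hN3', hN4']
  · rw [e]; push_cast; linarith [hN1, hN2, hN3, hN4]

/-- ★ `Λ₃₂(y) ≤ 3³²(y + y² + y³ + y⁴ + y⁵)` for `y ≥ 0` (`1 ≤ visits ≤ 5` on `ipwb 32`). [cite: MadrasSlade1993, Section 4.2, (4.2.2); Section 1.2, (1.2.16) (p. 11)] -/
theorem IPWB_thirtytwo_le {m : ℕ} (hm : m = 32) (hy : 0 ≤ y) : IPWB m y ≤ 3 ^ 32 * (y + y ^ 2 + y ^ 3 + y ^ 4 + y ^ 5) := by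
  classical
  have hterm : ∀ ω ∈ ipwb m, y ^ visits m ω ≤ y + y ^ 2 + y ^ 3 + y ^ 4 + y ^ 5 := by
    intro ω hω
    have h1 := one_le_visits_of_mem_ipwb hω
    have h5 : visits m ω ≤ 5 := visits_le_five_of_le_thirtyfive (by omega) (by omega) hω
    have hy2 : 0 ≤ y ^ 2 := pow_nonneg hy 2
    have hy3 : 0 ≤ y ^ 3 := pow_nonneg hy 3
    have hy4 : 0 ≤ y ^ 4 := pow_nonneg hy 4
    have hy5 : 0 ≤ y ^ 5 := pow_nonneg hy 5
    rcases Nat.lt_or_ge (visits m ω) 2 with hv | hv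
    · rw [show visits m ω = 1 by omega, pow_one]; linarith
    rcases Nat.lt_or_ge (visits m ω) 3 with hv' | hv'
    · rw [show visits m ω = 2 by omega]; linarith
    rcases Nat.lt_or_ge (visits m ω) 4 with hv'' | hv''
    · rw [show visits m ω = 3 by omega]; linarith
    rcases Nat.lt_or_ge (visits m ω) 5 with hv3 | hv3
    · rw [show visits m ω = 4 by omega]; linarith
    · rw [show visits m ω = 5 by omega]; linarith
  calc IPWB m y = ∑ ω ∈ ipwb m, y ^ visits m ω := rfl
    _ ≤ ∑ _ω ∈ ipwb m, (y + y ^ 2 + y ^ 3 + y ^ 4 + y ^ 5) := Finset.sum_le_sum hterm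
    _ = #(ipwb m) * (y + y ^ 2 + y ^ 3 + y ^ 4 + y ^ 5) := by rw [Finset.sum_const, nsmul_eq_mul]
    _ ≤ 3 ^ m * (y + y ^ 2 + y ^ 3 + y ^ 4 + y ^ 5) := mul_le_mul_of_nonneg_right (card_ipwb_le_three_pow m) (by positivity)
    _ = 3 ^ 32 * (y + y ^ 2 + y ^ 3 + y ^ 4 + y ^ 5) := by rw [hm]

/-! ### §2  Kesten's identity at order ten: the head sandwich with symbolic diagonal-ten class numbers -/

/-- The exact laws of the head `f₀, f₂, …, f₁₀` (tree: … «CENSUS-EIGHT-A», «CENSUS-NINE-A»). [cite: MadrasSlade1993, §4.2, (4.2.2) (p. 91)] -/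
private theorem head_laws_ti (y : ℝ) :
    pwbLaw y 0 = 0 ∧ pwbLaw y 2 = 0 ∧ pwbLaw y 3 = y / wallRate y ^ 6 ∧ pwbLaw y 4 = y / wallRate y ^ 8 ∧ pwbLaw y 5 = 3 * y / wallRate y ^ 10 ∧
      pwbLaw y 6 = (6 * y + y ^ 2) / wallRate y ^ 12 ∧ pwbLaw y 7 = (15 * y + 3 * y ^ 2) / wallRate y ^ 14 ∧
      pwbLaw y 8 = (38 * y + 11 * y ^ 2) / wallRate y ^ 16 ∧ pwbLaw y 9 = (98 * y + 34 * y ^ 2 + y ^ 3) / wallRate y ^ 18 ∧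
      pwbLaw y 10 = (267 * y + 99 * y ^ 2 + 7 * y ^ 3) / wallRate y ^ 20 := by
  refine ⟨pwbLaw_zero, ?_, ?_, ?_, ?_, ?_, ?_, ?_, ?_, ?_⟩
  · rw [pwbLaw_eq_ti 2 (m := 4) rfl, IPWB_four rfl, zero_div]
  · rw [pwbLaw_eq_ti 3 (m := 6) rfl, IPWB_six rfl]
  · rw [pwbLaw_eq_ti 4 (m := 8) rfl, IPWB_eight_eq rfl]
  · rw [pwbLaw_eq_ti 5 (m := 10) rfl, IPWB_ten_eq rfl]
  · rw [pwbLaw_eq_ti 6 (m := 12) rfl, IPWB_twelve_eq_six rfl]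
  · rw [pwbLaw_eq_ti 7 (m := 14) rfl, IPWB_fourteen_eq_fifteen rfl]
  · rw [pwbLaw_eq_ti 8 (m := 16) rfl, IPWB_sixteen_eq_thirtyEight rfl]
  · rw [pwbLaw_eq_ti 9 (m := 18) rfl, IPWB_eighteen_eq_ninetyEight rfl]
  · rw [pwbLaw_eq_ti 10 (m := 20) rfl, IPWB_twenty_eq_twoSixtySeven rfl]

open Classical in
/-- ★ **The head from above** (`y ≥ 0`): `Σ_{k ≤ 16} f_k(y) ≤ H₁₀(y) + CRUDE₁₀(y)` (five diagonal-ten class numbers SYMBOLIC; `CRUDE₁₀ = 3²⁴y/β²⁴ + 3²⁶(y + y²)/β²⁶ +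
3²⁸(y + y² + y³)/β²⁸ + 3³⁰(y + … + y⁴)/β³⁰ + 3³²(y + … + y⁵)/β³²`). [cite: MadrasSlade1993, §4.2, (4.2.2), (4.2.4) (p. 91)] -/
theorem sum_pwbLaw_range_seventeen_le {m₁ m₂ m₃ m₄ m₅ : ℕ} (h₁ : m₁ = 22) (h₂ : m₂ = 24) (h₃ : m₃ = 26) (h₄ : m₄ = 28) (h₅ : m₅ = 30) (hy : 0 ≤ y) :
    ∑ k ∈ range 17, pwbLaw y k ≤
      (y / wallRate y ^ 2 + y / wallRate y ^ 6 + y / wallRate y ^ 8 + 3 * y / wallRate y ^ 10 +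
        (6 * y + y ^ 2) / wallRate y ^ 12 + (15 * y + 3 * y ^ 2) / wallRate y ^ 14 + (38 * y + 11 * y ^ 2) / wallRate y ^ 16 +
        (98 * y + 34 * y ^ 2 + y ^ 3) / wallRate y ^ 18 + (267 * y + 99 * y ^ 2 + 7 * y ^ 3) / wallRate y ^ 20 +
        (#((ipwb m₁).filter fun ω => visits m₁ ω = 1) * y + 295 * y ^ 2 + 33 * y ^ 3) / wallRate y ^ 22 +
        (#((ipwb m₂).filter fun ω => visits m₂ ω = 2) * y ^ 2 + 132 * y ^ 3 + y ^ 4) / wallRate y ^ 24 +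
        (#((ipwb m₃).filter fun ω => visits m₃ ω = 3) * y ^ 3 + 16 * y ^ 4) / wallRate y ^ 26 +
        #((ipwb m₄).filter fun ω => visits m₄ ω = 4) * y ^ 4 / wallRate y ^ 28 +
        #((ipwb m₅).filter fun ω => visits m₅ ω = 5) * y ^ 5 / wallRate y ^ 30) +
      (3 ^ 24 * y / wallRate y ^ 24 + 3 ^ 26 * (y + y ^ 2) / wallRate y ^ 26 + 3 ^ 28 * (y + y ^ 2 + y ^ 3) / wallRate y ^ 28 +
          3 ^ 30 * (y + y ^ 2 + y ^ 3 + y ^ 4) / wallRate y ^ 30 + 3 ^ 32 * (y + y ^ 2 + y ^ 3 + y ^ 4 + y ^ 5) / wallRate y ^ 32) := by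
  subst h₁ h₂ h₃ h₄ h₅
  have hβ := wallRate_pos y
  obtain ⟨e0, e2, e3, e4, e5, e6, e7, e8, e9, e10⟩ := head_laws_ti y
  have e11 : pwbLaw y 11 = (#((ipwb 22).filter fun ω => visits 22 ω = 1) * y + 295 * y ^ 2 + 33 * y ^ 3) / wallRate y ^ 22 := by
    rw [pwbLaw_eq_ti 11 (m := 22) rfl, IPWB_twentytwo_eq_census_ten rfl]
  have e12 : pwbLaw y 12 ≤ (#((ipwb 24).filter fun ω => visits 24 ω = 2) * y ^ 2 + 132 * y ^ 3 + y ^ 4) / wallRate y ^ 24 + 3 ^ 24 * y / wallRate y ^ 24 := by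
    rw [pwbLaw_eq_ti 12 (m := 24) rfl, ← add_div]
    refine div_le_div_of_nonneg_right ?_ (pow_pos hβ 24).le
    have h := (IPWB_twentyfour_two_sided_ten (m := 24) rfl hy).2
    linarith
  have e13 : pwbLaw y 13 ≤ (#((ipwb 26).filter fun ω => visits 26 ω = 3) * y ^ 3 + 16 * y ^ 4) / wallRate y ^ 26 + 3 ^ 26 * (y + y ^ 2) / wallRate y ^ 26 := by
    rw [pwbLaw_eq_ti 13 (m := 26) rfl, ← add_div]
    refine div_le_div_of_nonneg_right ?_ (pow_pos hβ 26).le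
    have h := (IPWB_twentysix_two_sided_ten (m := 26) rfl hy).2
    linarith
  have e14 : pwbLaw y 14 ≤ #((ipwb 28).filter fun ω => visits 28 ω = 4) * y ^ 4 / wallRate y ^ 28 + 3 ^ 28 * (y + y ^ 2 + y ^ 3) / wallRate y ^ 28 := by
    rw [pwbLaw_eq_ti 14 (m := 28) rfl, ← add_div]
    refine div_le_div_of_nonneg_right ?_ (pow_pos hβ 28).le
    have h := (IPWB_twentyeight_two_sided (m := 28) rfl hy).2
    linarith
  have e15 : pwbLaw y 15 ≤ #((ipwb 30).filter fun ω => visits 30 ω = 5) * y ^ 5 / wallRate y ^ 30 + 3 ^ 30 * (y + y ^ 2 + y ^ 3 + y ^ 4) / wallRate y ^ 30 := by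
    rw [pwbLaw_eq_ti 15 (m := 30) rfl, ← add_div]
    refine div_le_div_of_nonneg_right ?_ (pow_pos hβ 30).le
    have h := (IPWB_thirty_two_sided (m := 30) rfl hy).2
    linarith
  have e16 : pwbLaw y 16 ≤ 3 ^ 32 * (y + y ^ 2 + y ^ 3 + y ^ 4 + y ^ 5) / wallRate y ^ 32 := by
    rw [pwbLaw_eq_ti 16 (m := 32) rfl]
    exact div_le_div_of_nonneg_right (IPWB_thirtytwo_le rfl hy) (pow_pos hβ 32).le
  have e1 := pwbLaw_one_le_div_ti hy
  simp only [Finset.sum_range_succ, Finset.sum_range_zero, e0, e2, e3, e4, e5, e6, e7, e8, e9, e10, e11]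
  linarith

open Classical in
/-- ★ **The head from below** (`y > 0`): `H₁₀(y) ≤ Σ_{k ≤ 16} f_k(y)`. [cite: MadrasSlade1993, §4.2, (4.2.2), (4.2.4) (p. 91)] -/
theorem head_le_sum_pwbLaw_range_seventeen {m₁ m₂ m₃ m₄ m₅ : ℕ} (h₁ : m₁ = 22) (h₂ : m₂ = 24) (h₃ : m₃ = 26) (h₄ : m₄ = 28) (h₅ : m₅ = 30) (hy : 0 < y) :
    y / wallRate y ^ 2 + y / wallRate y ^ 6 + y / wallRate y ^ 8 + 3 * y / wallRate y ^ 10 +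
        (6 * y + y ^ 2) / wallRate y ^ 12 + (15 * y + 3 * y ^ 2) / wallRate y ^ 14 + (38 * y + 11 * y ^ 2) / wallRate y ^ 16 +
        (98 * y + 34 * y ^ 2 + y ^ 3) / wallRate y ^ 18 + (267 * y + 99 * y ^ 2 + 7 * y ^ 3) / wallRate y ^ 20 +
        (#((ipwb m₁).filter fun ω => visits m₁ ω = 1) * y + 295 * y ^ 2 + 33 * y ^ 3) / wallRate y ^ 22 +
        (#((ipwb m₂).filter fun ω => visits m₂ ω = 2) * y ^ 2 + 132 * y ^ 3 + y ^ 4) / wallRate y ^ 24 +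
        (#((ipwb m₃).filter fun ω => visits m₃ ω = 3) * y ^ 3 + 16 * y ^ 4) / wallRate y ^ 26 +
        #((ipwb m₄).filter fun ω => visits m₄ ω = 4) * y ^ 4 / wallRate y ^ 28 +
        #((ipwb m₅).filter fun ω => visits m₅ ω = 5) * y ^ 5 / wallRate y ^ 30 ≤
      ∑ k ∈ range 17, pwbLaw y k := by
  subst h₁ h₂ h₃ h₄ h₅
  have hβ := wallRate_pos y
  obtain ⟨e0, e2, e3, e4, e5, e6, e7, e8, e9, e10⟩ := head_laws_ti y
  have e11 : pwbLaw y 11 = (#((ipwb 22).filter fun ω => visits 22 ω = 1) * y + 295 * y ^ 2 + 33 * y ^ 3) / wallRate y ^ 22 := by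
    rw [pwbLaw_eq_ti 11 (m := 22) rfl, IPWB_twentytwo_eq_census_ten rfl]
  have e12 : (#((ipwb 24).filter fun ω => visits 24 ω = 2) * y ^ 2 + 132 * y ^ 3 + y ^ 4) / wallRate y ^ 24 ≤ pwbLaw y 12 := by
    rw [pwbLaw_eq_ti 12 (m := 24) rfl]
    exact div_le_div_of_nonneg_right (IPWB_twentyfour_two_sided_ten (m := 24) rfl hy.le).1 (pow_pos hβ 24).le
  have e13 : (#((ipwb 26).filter fun ω => visits 26 ω = 3) * y ^ 3 + 16 * y ^ 4) / wallRate y ^ 26 ≤ pwbLaw y 13 := by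
    rw [pwbLaw_eq_ti 13 (m := 26) rfl]
    exact div_le_div_of_nonneg_right (IPWB_twentysix_two_sided_ten (m := 26) rfl hy.le).1 (pow_pos hβ 26).le
  have e14 : #((ipwb 28).filter fun ω => visits 28 ω = 4) * y ^ 4 / wallRate y ^ 28 ≤ pwbLaw y 14 := by
    rw [pwbLaw_eq_ti 14 (m := 28) rfl]
    exact div_le_div_of_nonneg_right (IPWB_twentyeight_two_sided (m := 28) rfl hy.le).1 (pow_pos hβ 28).le
  have e15 : #((ipwb 30).filter fun ω => visits 30 ω = 5) * y ^ 5 / wallRate y ^ 30 ≤ pwbLaw y 15 := by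
    rw [pwbLaw_eq_ti 15 (m := 30) rfl]
    exact div_le_div_of_nonneg_right (IPWB_thirty_two_sided (m := 30) rfl hy.le).1 (pow_pos hβ 30).le
  have e16 : 0 ≤ pwbLaw y 16 := pwbLaw_nonneg hy.le 16
  have e1 := div_sq_wallRate_le_pwbLaw_one hy
  simp only [Finset.sum_range_succ, Finset.sum_range_zero, e0, e2, e3, e4, e5, e6, e7, e8, e9, e10, e11]
  linarith

/-- `Σ_{k ≤ n} f_k(y) ≤ 1` for `y > μ³` (partial sums of Kesten's identity). [cite: MadrasSlade1993, §4.2, (4.2.4), Theorem 4.2.2 (pp. 91–92)] -/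
private theorem sum_pwbLaw_range_le_one_ti (hy : hexConnectiveConstant ^ 3 < y) (n : ℕ) :
    ∑ k ∈ range n, pwbLaw y k ≤ 1 := by
  have hμ := hexConnectiveConstant_pos
  have hy0 : 0 < y := lt_of_le_of_lt (by positivity) hy
  exact sum_le_hasSum (range n) (fun k _ => pwbLaw_nonneg hy0.le k) (hasSum_pwbLaw_of_cube_lt hy)

open Classical in
/-- ★★ **The order-ten head sandwich** for `y > μ³`: `1 − Aθ₃^{16} − CRUDE₁₀(y) ≤ H₁₀(y) ≤ 1` (tail at `n = 16`: `θ₃^{16} ≍ y^{−32/3} = o(y⁻¹⁰)`; crude terms `O(y⁻¹¹)`).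
[cite: MadrasSlade1993, §4.2, (4.2.2), (4.2.4), Theorem 4.2.2 (pp. 91–92)] [cite: Kesten1963SAW, §4] -/
theorem kesten_head_ten_sandwich_of_cube_lt {m₁ m₂ m₃ m₄ m₅ : ℕ} (h₁ : m₁ = 22) (h₂ : m₂ = 24) (h₃ : m₃ = 26) (h₄ : m₄ = 28) (h₅ : m₅ = 30)
    (hy : hexConnectiveConstant ^ 3 < y) :
    1 - (hexConnectiveConstant ^ 2 + y ^ ((2 : ℝ) / 3) / hexConnectiveConstant ^ 2) *
          (hexConnectiveConstant ^ 2 / y ^ ((2 : ℝ) / 3)) / (1 - hexConnectiveConstant ^ 2 / y ^ ((2 : ℝ) / 3)) *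
          (hexConnectiveConstant ^ 2 / y ^ ((2 : ℝ) / 3)) ^ 16 -
        (3 ^ 24 * y / wallRate y ^ 24 + 3 ^ 26 * (y + y ^ 2) / wallRate y ^ 26 + 3 ^ 28 * (y + y ^ 2 + y ^ 3) / wallRate y ^ 28 +
          3 ^ 30 * (y + y ^ 2 + y ^ 3 + y ^ 4) / wallRate y ^ 30 + 3 ^ 32 * (y + y ^ 2 + y ^ 3 + y ^ 4 + y ^ 5) / wallRate y ^ 32) ≤
      y / wallRate y ^ 2 + y / wallRate y ^ 6 + y / wallRate y ^ 8 + 3 * y / wallRate y ^ 10 +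
        (6 * y + y ^ 2) / wallRate y ^ 12 + (15 * y + 3 * y ^ 2) / wallRate y ^ 14 + (38 * y + 11 * y ^ 2) / wallRate y ^ 16 +
        (98 * y + 34 * y ^ 2 + y ^ 3) / wallRate y ^ 18 + (267 * y + 99 * y ^ 2 + 7 * y ^ 3) / wallRate y ^ 20 +
        (#((ipwb m₁).filter fun ω => visits m₁ ω = 1) * y + 295 * y ^ 2 + 33 * y ^ 3) / wallRate y ^ 22 +
        (#((ipwb m₂).filter fun ω => visits m₂ ω = 2) * y ^ 2 + 132 * y ^ 3 + y ^ 4) / wallRate y ^ 24 +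
        (#((ipwb m₃).filter fun ω => visits m₃ ω = 3) * y ^ 3 + 16 * y ^ 4) / wallRate y ^ 26 +
        #((ipwb m₄).filter fun ω => visits m₄ ω = 4) * y ^ 4 / wallRate y ^ 28 +
        #((ipwb m₅).filter fun ω => visits m₅ ω = 5) * y ^ 5 / wallRate y ^ 30 ∧
    y / wallRate y ^ 2 + y / wallRate y ^ 6 + y / wallRate y ^ 8 + 3 * y / wallRate y ^ 10 +
        (6 * y + y ^ 2) / wallRate y ^ 12 + (15 * y + 3 * y ^ 2) / wallRate y ^ 14 + (38 * y + 11 * y ^ 2) / wallRate y ^ 16 +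
        (98 * y + 34 * y ^ 2 + y ^ 3) / wallRate y ^ 18 + (267 * y + 99 * y ^ 2 + 7 * y ^ 3) / wallRate y ^ 20 +
        (#((ipwb m₁).filter fun ω => visits m₁ ω = 1) * y + 295 * y ^ 2 + 33 * y ^ 3) / wallRate y ^ 22 +
        (#((ipwb m₂).filter fun ω => visits m₂ ω = 2) * y ^ 2 + 132 * y ^ 3 + y ^ 4) / wallRate y ^ 24 +
        (#((ipwb m₃).filter fun ω => visits m₃ ω = 3) * y ^ 3 + 16 * y ^ 4) / wallRate y ^ 26 +
        #((ipwb m₄).filter fun ω => visits m₄ ω = 4) * y ^ 4 / wallRate y ^ 28 +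
        #((ipwb m₅).filter fun ω => visits m₅ ω = 5) * y ^ 5 / wallRate y ^ 30 ≤ 1 := by
  have hμ := hexConnectiveConstant_pos
  have hy0 : 0 < y := lt_of_le_of_lt (by positivity) hy
  have htail := one_sub_sum_pwbLaw_le_of_cube_lt hy 16
  have hup := sum_pwbLaw_range_seventeen_le h₁ h₂ h₃ h₄ h₅ hy0.le
  have hlow := head_le_sum_pwbLaw_range_seventeen h₁ h₂ h₃ h₄ h₅ hy0
  have hone := sum_pwbLaw_range_le_one_ti hy 17
  constructor
  · linarith
  · linarith

/-! ### §3  The tail is negligible at order ten: `y⁹ β² (Aθ₃^{16} + CRUDE₁₀) → 0` -/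

/-- ★ The envelope part: `y¹⁰ · Aθ₃^{16} → 0` (`= μ^{32} · (1 + μ⁴/y^{2/3})/(1 − μ²/y^{2/3}) · y^{−2/3}`). [cite: MadrasSlade1993, Section 4.2, remark before (4.2.21) (p. 94)] -/
theorem tendsto_pow_ten_mul_envelope_tail :
    Tendsto (fun y : ℝ => y ^ 10 *
      ((hexConnectiveConstant ^ 2 + y ^ ((2 : ℝ) / 3) / hexConnectiveConstant ^ 2) *
          (hexConnectiveConstant ^ 2 / y ^ ((2 : ℝ) / 3)) / (1 - hexConnectiveConstant ^ 2 / y ^ ((2 : ℝ) / 3)) *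
          (hexConnectiveConstant ^ 2 / y ^ ((2 : ℝ) / 3)) ^ 16)) atTop (𝓝 0) := by
  have hμ := hexConnectiveConstant_pos
  have hs : Tendsto (fun y : ℝ => y ^ ((2 : ℝ) / 3)) atTop atTop := tendsto_rpow_atTop (by norm_num)
  have hc : Tendsto (fun y : ℝ => (y ^ ((2 : ℝ) / 3))⁻¹) atTop (𝓝 0) := hs.inv_tendsto_atTop
  have hA : Tendsto (fun y : ℝ => (hexConnectiveConstant ^ 4 / y ^ ((2 : ℝ) / 3) + 1) /
      (1 - hexConnectiveConstant ^ 2 / y ^ ((2 : ℝ) / 3))) atTop (𝓝 ((0 + 1) / (1 - 0))) :=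
    ((tendsto_const_nhds.div_atTop hs).add tendsto_const_nhds).div
      (tendsto_const_nhds.sub (tendsto_const_nhds.div_atTop hs)) (by norm_num)
  have h := (hA.const_mul (hexConnectiveConstant ^ 32)).mul hc
  rw [show hexConnectiveConstant ^ 32 * ((0 + 1) / (1 - 0)) * (0 : ℝ) = 0 by ring] at h
  refine h.congr' ?_
  filter_upwards [eventually_gt_atTop (hexConnectiveConstant ^ 3)] with y hy
  have hy0 : 0 < y := lt_of_le_of_lt (by positivity) hy
  have hs0 : 0 < y ^ ((2 : ℝ) / 3) := Real.rpow_pos_of_pos hy0 _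
  have hθ := theta_cube_lt_one hy
  have hD : 1 - hexConnectiveConstant ^ 2 / y ^ ((2 : ℝ) / 3) ≠ 0 := by linarith
  have hD' : y ^ ((2 : ℝ) / 3) - hexConnectiveConstant ^ 2 ≠ 0 := by
    intro h0
    apply hD
    rw [sub_eq_zero] at h0
    rw [← h0, div_self hs0.ne', sub_self]
  rw [div_pow, ← pow_mul, show 2 * 16 = 32 by norm_num, rpow_two_thirds_pow_sixteen_ti hy0]
  field_simp

/-- ★ The crude-count part: `y¹⁰ · CRUDE₁₀(y) → 0`. [cite: BeatonBousquetMelouDeGierDuminilCopinGuttmann2014, Section 3.1, Proposition 5 (arXiv v5 p. 9)] -/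
theorem tendsto_pow_ten_mul_crude_tail :
    Tendsto (fun y : ℝ => y ^ 10 * (3 ^ 24 * y / wallRate y ^ 24 + 3 ^ 26 * (y + y ^ 2) / wallRate y ^ 26 + 3 ^ 28 * (y + y ^ 2 + y ^ 3) / wallRate y ^ 28 +
          3 ^ 30 * (y + y ^ 2 + y ^ 3 + y ^ 4) / wallRate y ^ 30 + 3 ^ 32 * (y + y ^ 2 + y ^ 3 + y ^ 4 + y ^ 5) / wallRate y ^ 32)) atTop (𝓝 0) := by
  have hr := tendsto_div_sq_wallRate_ti
  have hu : Tendsto (fun y : ℝ => y⁻¹) atTop (𝓝 0) := tendsto_inv_atTop_zero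
  have h := ((((((hr.pow 12).const_mul ((3 : ℝ) ^ 24)).mul hu).add
    (((hr.pow 13).const_mul ((3 : ℝ) ^ 26)).mul ((hu.pow 2).add hu))).add
    (((hr.pow 14).const_mul ((3 : ℝ) ^ 28)).mul (((hu.pow 3).add (hu.pow 2)).add hu))).add
    (((hr.pow 15).const_mul ((3 : ℝ) ^ 30)).mul ((((hu.pow 4).add (hu.pow 3)).add (hu.pow 2)).add hu))).add
    (((hr.pow 16).const_mul ((3 : ℝ) ^ 32)).mul (((((hu.pow 5).add (hu.pow 4)).add (hu.pow 3)).add (hu.pow 2)).add hu))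
  refine Tendsto.congr' ?_ (tendsto_of_tendsto_of_eq_ti h (by norm_num))
  filter_upwards [eventually_gt_atTop (0 : ℝ)] with y hy
  have hB : wallRate y ≠ 0 := (wallRate_pos y).ne'
  have hy' : y ≠ 0 := hy.ne'
  field_simp

/-- ★★ **The whole tail is negligible at order ten**: `y⁹ β(y)² (Aθ₃^{16} + CRUDE₁₀(y)) → 0`. [cite: MadrasSlade1993, Section 4.2, Theorem 4.2.2 (pp. 91–92)] -/
theorem tendsto_pow_nine_mul_sq_wallRate_mul_tail_ten :
    Tendsto (fun y : ℝ => y ^ 9 * wallRate y ^ 2 *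
      ((hexConnectiveConstant ^ 2 + y ^ ((2 : ℝ) / 3) / hexConnectiveConstant ^ 2) *
          (hexConnectiveConstant ^ 2 / y ^ ((2 : ℝ) / 3)) / (1 - hexConnectiveConstant ^ 2 / y ^ ((2 : ℝ) / 3)) *
          (hexConnectiveConstant ^ 2 / y ^ ((2 : ℝ) / 3)) ^ 16 +
        (3 ^ 24 * y / wallRate y ^ 24 + 3 ^ 26 * (y + y ^ 2) / wallRate y ^ 26 + 3 ^ 28 * (y + y ^ 2 + y ^ 3) / wallRate y ^ 28 +
          3 ^ 30 * (y + y ^ 2 + y ^ 3 + y ^ 4) / wallRate y ^ 30 + 3 ^ 32 * (y + y ^ 2 + y ^ 3 + y ^ 4 + y ^ 5) / wallRate y ^ 32))) atTop (𝓝 0) := by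
  have h := tendsto_sq_wallRate_div_ti.mul (tendsto_pow_ten_mul_envelope_tail.add tendsto_pow_ten_mul_crude_tail)
  rw [add_zero, mul_zero] at h
  refine h.congr' ?_
  filter_upwards [eventually_gt_atTop (0 : ℝ)] with y hy
  have hy' : y ≠ 0 := hy.ne'
  field_simp

/-! ### §4  The two-sided closed form on `y > μ³` -/

set_option maxHeartbeats 400000 in
open Classical in
/-- ★★ **The order-ten two-sided closed form** for `y > μ³`: `G(y, r) ≤ T(y) ≤ G(y, r) + y⁹ β² (Aθ₃^{16} + CRUDE₁₀(y))`,
`T := y⁹(β² − y − … − 18/y⁷ − 15/y⁸)`, `G := y⁸(r² − 1) + y⁷(r³ − 1) + y⁶(3r⁴ + r⁵ − 2) + y⁵(6r⁵ + 3r⁶ − 4) + y⁴(15r⁶ + 11r⁷ + r⁸ − 6) + y³(38r⁷ + 34r⁸ + 7r⁹ − 12) +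
y²(98r⁸ + 99r⁹ + 33r¹⁰ + r¹¹ − 18) + y(267r⁹ + 295r¹⁰ + 132r¹¹ + 16r¹² − 15) + (N₁₁,₁r¹⁰ + N₁₂,₂r¹¹ + N₁₃,₃r¹² + N₁₄,₄r¹³ + N₁₅,₅r¹⁴)`
(exact identity `T − G = y⁹β²(1 − H₁₀)` plus the sandwich of §2). [cite: Kesten1963SAW, Section 4] [cite: MadrasSlade1993, Section 4.2, (4.2.2), (4.2.4), Theorem 4.2.2 (pp. 91–92)] -/
theorem tenth_order_two_sided_of_cube_lt {m₁ m₂ m₃ m₄ m₅ : ℕ} (h₁ : m₁ = 22) (h₂ : m₂ = 24) (h₃ : m₃ = 26) (h₄ : m₄ = 28) (h₅ : m₅ = 30)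
    (hy : hexConnectiveConstant ^ 3 < y) :
    y ^ 8 * ((y / wallRate y ^ 2) ^ 2 - 1) + y ^ 7 * ((y / wallRate y ^ 2) ^ 3 - 1) +
        y ^ 6 * (3 * (y / wallRate y ^ 2) ^ 4 + (y / wallRate y ^ 2) ^ 5 - 2) +
        y ^ 5 * (6 * (y / wallRate y ^ 2) ^ 5 + 3 * (y / wallRate y ^ 2) ^ 6 - 4) +
        y ^ 4 * (15 * (y / wallRate y ^ 2) ^ 6 + 11 * (y / wallRate y ^ 2) ^ 7 + (y / wallRate y ^ 2) ^ 8 - 6) +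
        y ^ 3 * (38 * (y / wallRate y ^ 2) ^ 7 + 34 * (y / wallRate y ^ 2) ^ 8 + 7 * (y / wallRate y ^ 2) ^ 9 - 12) +
        y ^ 2 * (98 * (y / wallRate y ^ 2) ^ 8 + 99 * (y / wallRate y ^ 2) ^ 9 + 33 * (y / wallRate y ^ 2) ^ 10 + (y / wallRate y ^ 2) ^ 11 - 18) +
        y * (267 * (y / wallRate y ^ 2) ^ 9 + 295 * (y / wallRate y ^ 2) ^ 10 + 132 * (y / wallRate y ^ 2) ^ 11 + 16 * (y / wallRate y ^ 2) ^ 12 - 15) +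
        (#((ipwb m₁).filter fun ω => visits m₁ ω = 1) * (y / wallRate y ^ 2) ^ 10 + #((ipwb m₂).filter fun ω => visits m₂ ω = 2) * (y / wallRate y ^ 2) ^ 11 +
          #((ipwb m₃).filter fun ω => visits m₃ ω = 3) * (y / wallRate y ^ 2) ^ 12 + #((ipwb m₄).filter fun ω => visits m₄ ω = 4) * (y / wallRate y ^ 2) ^ 13 +
          #((ipwb m₅).filter fun ω => visits m₅ ω = 5) * (y / wallRate y ^ 2) ^ 14) ≤
      y ^ 9 * (wallRate y ^ 2 - y - 1 / y - 1 / y ^ 2 - 2 / y ^ 3 - 4 / y ^ 4 - 6 / y ^ 5 - 12 / y ^ 6 - 18 / y ^ 7 - 15 / y ^ 8) ∧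
    y ^ 9 * (wallRate y ^ 2 - y - 1 / y - 1 / y ^ 2 - 2 / y ^ 3 - 4 / y ^ 4 - 6 / y ^ 5 - 12 / y ^ 6 - 18 / y ^ 7 - 15 / y ^ 8) ≤
      (y ^ 8 * ((y / wallRate y ^ 2) ^ 2 - 1) + y ^ 7 * ((y / wallRate y ^ 2) ^ 3 - 1) +
        y ^ 6 * (3 * (y / wallRate y ^ 2) ^ 4 + (y / wallRate y ^ 2) ^ 5 - 2) +
        y ^ 5 * (6 * (y / wallRate y ^ 2) ^ 5 + 3 * (y / wallRate y ^ 2) ^ 6 - 4) +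
        y ^ 4 * (15 * (y / wallRate y ^ 2) ^ 6 + 11 * (y / wallRate y ^ 2) ^ 7 + (y / wallRate y ^ 2) ^ 8 - 6) +
        y ^ 3 * (38 * (y / wallRate y ^ 2) ^ 7 + 34 * (y / wallRate y ^ 2) ^ 8 + 7 * (y / wallRate y ^ 2) ^ 9 - 12) +
        y ^ 2 * (98 * (y / wallRate y ^ 2) ^ 8 + 99 * (y / wallRate y ^ 2) ^ 9 + 33 * (y / wallRate y ^ 2) ^ 10 + (y / wallRate y ^ 2) ^ 11 - 18) +
        y * (267 * (y / wallRate y ^ 2) ^ 9 + 295 * (y / wallRate y ^ 2) ^ 10 + 132 * (y / wallRate y ^ 2) ^ 11 + 16 * (y / wallRate y ^ 2) ^ 12 - 15) +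
        (#((ipwb m₁).filter fun ω => visits m₁ ω = 1) * (y / wallRate y ^ 2) ^ 10 + #((ipwb m₂).filter fun ω => visits m₂ ω = 2) * (y / wallRate y ^ 2) ^ 11 +
          #((ipwb m₃).filter fun ω => visits m₃ ω = 3) * (y / wallRate y ^ 2) ^ 12 + #((ipwb m₄).filter fun ω => visits m₄ ω = 4) * (y / wallRate y ^ 2) ^ 13 +
          #((ipwb m₅).filter fun ω => visits m₅ ω = 5) * (y / wallRate y ^ 2) ^ 14)) +
      y ^ 9 * wallRate y ^ 2 *
        ((hexConnectiveConstant ^ 2 + y ^ ((2 : ℝ) / 3) / hexConnectiveConstant ^ 2) *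
          (hexConnectiveConstant ^ 2 / y ^ ((2 : ℝ) / 3)) / (1 - hexConnectiveConstant ^ 2 / y ^ ((2 : ℝ) / 3)) *
          (hexConnectiveConstant ^ 2 / y ^ ((2 : ℝ) / 3)) ^ 16 +
          (3 ^ 24 * y / wallRate y ^ 24 + 3 ^ 26 * (y + y ^ 2) / wallRate y ^ 26 + 3 ^ 28 * (y + y ^ 2 + y ^ 3) / wallRate y ^ 28 +
          3 ^ 30 * (y + y ^ 2 + y ^ 3 + y ^ 4) / wallRate y ^ 30 + 3 ^ 32 * (y + y ^ 2 + y ^ 3 + y ^ 4 + y ^ 5) / wallRate y ^ 32)) := by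
  have hμ := hexConnectiveConstant_pos
  have hy0 : 0 < y := lt_of_le_of_lt (by positivity) hy
  have hβ := wallRate_pos y
  have hB : wallRate y ≠ 0 := hβ.ne'
  obtain ⟨hlow, hone⟩ := kesten_head_ten_sandwich_of_cube_lt h₁ h₂ h₃ h₄ h₅ hy
  set N₁ := (#((ipwb m₁).filter fun ω => visits m₁ ω = 1) : ℝ) with hN₁
  set N₂ := (#((ipwb m₂).filter fun ω => visits m₂ ω = 2) : ℝ) with hN₂
  set N₃ := (#((ipwb m₃).filter fun ω => visits m₃ ω = 3) : ℝ) with hN₃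
  set N₄ := (#((ipwb m₄).filter fun ω => visits m₄ ω = 4) : ℝ) with hN₄
  set N₅ := (#((ipwb m₅).filter fun ω => visits m₅ ω = 5) : ℝ) with hN₅
  set a := (hexConnectiveConstant ^ 2 + y ^ ((2 : ℝ) / 3) / hexConnectiveConstant ^ 2) *
          (hexConnectiveConstant ^ 2 / y ^ ((2 : ℝ) / 3)) / (1 - hexConnectiveConstant ^ 2 / y ^ ((2 : ℝ) / 3)) *
          (hexConnectiveConstant ^ 2 / y ^ ((2 : ℝ) / 3)) ^ 16 with ha
  set b := 3 ^ 24 * y / wallRate y ^ 24 + 3 ^ 26 * (y + y ^ 2) / wallRate y ^ 26 + 3 ^ 28 * (y + y ^ 2 + y ^ 3) / wallRate y ^ 28 +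
          3 ^ 30 * (y + y ^ 2 + y ^ 3 + y ^ 4) / wallRate y ^ 30 + 3 ^ 32 * (y + y ^ 2 + y ^ 3 + y ^ 4 + y ^ 5) / wallRate y ^ 32 with hb
  set K := y / wallRate y ^ 2 + y / wallRate y ^ 6 + y / wallRate y ^ 8 + 3 * y / wallRate y ^ 10 +
      (6 * y + y ^ 2) / wallRate y ^ 12 + (15 * y + 3 * y ^ 2) / wallRate y ^ 14 + (38 * y + 11 * y ^ 2) / wallRate y ^ 16 +
      (98 * y + 34 * y ^ 2 + y ^ 3) / wallRate y ^ 18 + (267 * y + 99 * y ^ 2 + 7 * y ^ 3) / wallRate y ^ 20 +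
      (N₁ * y + 295 * y ^ 2 + 33 * y ^ 3) / wallRate y ^ 22 + (N₂ * y ^ 2 + 132 * y ^ 3 + y ^ 4) / wallRate y ^ 24 +
      (N₃ * y ^ 3 + 16 * y ^ 4) / wallRate y ^ 26 + N₄ * y ^ 4 / wallRate y ^ 28 + N₅ * y ^ 5 / wallRate y ^ 30 with hK
  have key : y ^ 9 * (wallRate y ^ 2 - y - 1 / y - 1 / y ^ 2 - 2 / y ^ 3 - 4 / y ^ 4 - 6 / y ^ 5 - 12 / y ^ 6 - 18 / y ^ 7 - 15 / y ^ 8) -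
      (y ^ 8 * ((y / wallRate y ^ 2) ^ 2 - 1) + y ^ 7 * ((y / wallRate y ^ 2) ^ 3 - 1) +
        y ^ 6 * (3 * (y / wallRate y ^ 2) ^ 4 + (y / wallRate y ^ 2) ^ 5 - 2) +
        y ^ 5 * (6 * (y / wallRate y ^ 2) ^ 5 + 3 * (y / wallRate y ^ 2) ^ 6 - 4) +
        y ^ 4 * (15 * (y / wallRate y ^ 2) ^ 6 + 11 * (y / wallRate y ^ 2) ^ 7 + (y / wallRate y ^ 2) ^ 8 - 6) +
        y ^ 3 * (38 * (y / wallRate y ^ 2) ^ 7 + 34 * (y / wallRate y ^ 2) ^ 8 + 7 * (y / wallRate y ^ 2) ^ 9 - 12) +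
        y ^ 2 * (98 * (y / wallRate y ^ 2) ^ 8 + 99 * (y / wallRate y ^ 2) ^ 9 + 33 * (y / wallRate y ^ 2) ^ 10 + (y / wallRate y ^ 2) ^ 11 - 18) +
        y * (267 * (y / wallRate y ^ 2) ^ 9 + 295 * (y / wallRate y ^ 2) ^ 10 + 132 * (y / wallRate y ^ 2) ^ 11 + 16 * (y / wallRate y ^ 2) ^ 12 - 15) +
        (N₁ * (y / wallRate y ^ 2) ^ 10 + N₂ * (y / wallRate y ^ 2) ^ 11 + N₃ * (y / wallRate y ^ 2) ^ 12 + N₄ * (y / wallRate y ^ 2) ^ 13 + N₅ * (y / wallRate y ^ 2) ^ 14)) =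
      y ^ 9 * wallRate y ^ 2 * (1 - K) := by
    rw [hK]
    field_simp
    ring
  have hpos : 0 ≤ y ^ 9 * wallRate y ^ 2 := by positivity
  have h0 : 0 ≤ y ^ 9 * wallRate y ^ 2 * (1 - K) := mul_nonneg hpos (sub_nonneg.2 hone)
  have h1 : 1 - K ≤ a + b := by linarith
  have h2 : y ^ 9 * wallRate y ^ 2 * (1 - K) ≤ y ^ 9 * wallRate y ^ 2 * (a + b) := mul_le_mul_of_nonneg_left h1 hpos
  constructor
  · linarith
  · linarith

/-! ### §5  The limit of the comparison function: `G(y, r) → N₁₁,₁ + N₁₂,₂ + N₁₃,₃ + N₁₄,₄ + N₁₅,₅ − 2155` -/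

open Classical in
/-- ★★ **The comparison function tends to the diagonal-ten census minus 2155**: its numeric part is an exact polynomial in the tower `A, Q, P, H, K, L, M` and
`u = 1/y` (56 monomials, `ring`), tending to `−2155`, and `N r^s → N`. [cite: BeatonBousquetMelouDeGierDuminilCopinGuttmann2014, Section 3.1, Proposition 5 (arXiv v5 p. 9)] [cite: MadrasSlade1993, Section 4.2, (4.2.4) (p. 91)] -/
theorem tendsto_tenth_order_comparison (m₁ m₂ m₃ m₄ m₅ : ℕ) :
    Tendsto (fun y : ℝ => y ^ 8 * ((y / wallRate y ^ 2) ^ 2 - 1) + y ^ 7 * ((y / wallRate y ^ 2) ^ 3 - 1) +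
        y ^ 6 * (3 * (y / wallRate y ^ 2) ^ 4 + (y / wallRate y ^ 2) ^ 5 - 2) +
        y ^ 5 * (6 * (y / wallRate y ^ 2) ^ 5 + 3 * (y / wallRate y ^ 2) ^ 6 - 4) +
        y ^ 4 * (15 * (y / wallRate y ^ 2) ^ 6 + 11 * (y / wallRate y ^ 2) ^ 7 + (y / wallRate y ^ 2) ^ 8 - 6) +
        y ^ 3 * (38 * (y / wallRate y ^ 2) ^ 7 + 34 * (y / wallRate y ^ 2) ^ 8 + 7 * (y / wallRate y ^ 2) ^ 9 - 12) +
        y ^ 2 * (98 * (y / wallRate y ^ 2) ^ 8 + 99 * (y / wallRate y ^ 2) ^ 9 + 33 * (y / wallRate y ^ 2) ^ 10 + (y / wallRate y ^ 2) ^ 11 - 18) +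
        y * (267 * (y / wallRate y ^ 2) ^ 9 + 295 * (y / wallRate y ^ 2) ^ 10 + 132 * (y / wallRate y ^ 2) ^ 11 + 16 * (y / wallRate y ^ 2) ^ 12 - 15) +
        (#((ipwb m₁).filter fun ω => visits m₁ ω = 1) * (y / wallRate y ^ 2) ^ 10 + #((ipwb m₂).filter fun ω => visits m₂ ω = 2) * (y / wallRate y ^ 2) ^ 11 +
          #((ipwb m₃).filter fun ω => visits m₃ ω = 3) * (y / wallRate y ^ 2) ^ 12 + #((ipwb m₄).filter fun ω => visits m₄ ω = 4) * (y / wallRate y ^ 2) ^ 13 +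
          #((ipwb m₅).filter fun ω => visits m₅ ω = 5) * (y / wallRate y ^ 2) ^ 14))
      atTop (𝓝 ((#((ipwb m₁).filter fun ω => visits m₁ ω = 1) : ℝ) + #((ipwb m₂).filter fun ω => visits m₂ ω = 2) +
        #((ipwb m₃).filter fun ω => visits m₃ ω = 3) + #((ipwb m₄).filter fun ω => visits m₄ ω = 4) + #((ipwb m₅).filter fun ω => visits m₅ ω = 5) - 2155)) := by
  set N₁ := (#((ipwb m₁).filter fun ω => visits m₁ ω = 1) : ℝ) with hN₁
  set N₂ := (#((ipwb m₂).filter fun ω => visits m₂ ω = 2) : ℝ) with hN₂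
  set N₃ := (#((ipwb m₃).filter fun ω => visits m₃ ω = 3) : ℝ) with hN₃
  set N₄ := (#((ipwb m₄).filter fun ω => visits m₄ ω = 4) : ℝ) with hN₄
  set N₅ := (#((ipwb m₅).filter fun ω => visits m₅ ω = 5) : ℝ) with hN₅
  have hr := tendsto_div_sq_wallRate_ti
  have hA := tendsto_sq_mul_one_sub_div_wallRate_sq
  have hQ := tendsto_cube_mul_one_sub_div_sub
  have hP := tendsto_pow_four_mul_one_sub_div_sub
  have hH := tendsto_pow_five_mul_one_sub_div_sub
  have hK := tendsto_pow_six_mul_one_sub_div_sub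
  have hL := tendsto_pow_seven_mul_one_sub_div_sub
  have hM := tendsto_pow_eight_mul_one_sub_div_sub
  have hu : Tendsto (fun y : ℝ => y⁻¹) atTop (𝓝 0) := tendsto_inv_atTop_zero
  have hN := (((((hr.pow 10).const_mul N₁).add ((hr.pow 11).const_mul N₂)).add ((hr.pow 12).const_mul N₃)).add ((hr.pow 13).const_mul N₄)).add
    ((hr.pow 14).const_mul N₅)
  have h0 := (((((((((((((((((((((((((((((((((((((((((((((((((((((((((hA.pow 3).const_mul ((-22) : ℝ)).add
      (((hA.pow 2).mul hQ).const_mul ((-1) : ℝ))).add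
      ((hA.pow 2).const_mul (484 : ℝ))).add
      ((hA.mul hQ).const_mul (104 : ℝ))).add
      (hA.const_mul ((-2016) : ℝ))).add
      ((hQ.pow 2).const_mul (28 : ℝ))).add
      ((hQ.mul hP).const_mul (3 : ℝ))).add
      (hQ.const_mul ((-497) : ℝ))).add
      (hP.pow 2)).add
      (hP.const_mul ((-116) : ℝ))).add
      (hH.const_mul ((-40) : ℝ))).add
      (hK.const_mul ((-15) : ℝ))).add
      (hL.const_mul ((-3) : ℝ))).add
      (hM.const_mul ((-2) : ℝ))).add
      (((hA.pow 3).mul hu).const_mul ((-120) : ℝ))).add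
      (((hA.pow 2).mul hu).const_mul (2002 : ℝ))).add
      ((hA.mul hu).const_mul ((-6997) : ℝ))).add
      (((hA.pow 4).mul (hu.pow 2)).const_mul (8 : ℝ))).add
      (((hA.pow 3).mul (hu.pow 2)).const_mul ((-741) : ℝ))).add
      (((hA.pow 2).mul (hu.pow 2)).const_mul (7848 : ℝ))).add
      (((hA.pow 4).mul (hu.pow 3)).const_mul (75 : ℝ))).add
      (((hA.pow 3).mul (hu.pow 3)).const_mul ((-3822) : ℝ))).add
      (((hA.pow 2).mul (hu.pow 3)).const_mul (31203 : ℝ))).add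
      (((hA.pow 5).mul (hu.pow 4)).const_mul ((-1) : ℝ))).add
      (((hA.pow 4).mul (hu.pow 4)).const_mul (680 : ℝ))).add
      (((hA.pow 3).mul (hu.pow 4)).const_mul ((-17929) : ℝ))).add
      (((hA.pow 5).mul (hu.pow 5)).const_mul ((-24) : ℝ))).add
      (((hA.pow 4).mul (hu.pow 5)).const_mul (4592 : ℝ))).add
      (((hA.pow 3).mul (hu.pow 5)).const_mul ((-83128) : ℝ))).add
      (((hA.pow 5).mul (hu.pow 6)).const_mul ((-377) : ℝ))).add
      (((hA.pow 4).mul (hu.pow 6)).const_mul (26594 : ℝ))).add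
      (((hA.pow 6).mul (hu.pow 7)).const_mul (3 : ℝ))).add
      (((hA.pow 5).mul (hu.pow 7)).const_mul ((-3584) : ℝ))).add
      (((hA.pow 4).mul (hu.pow 7)).const_mul (147072 : ℝ))).add
      (((hA.pow 6).mul (hu.pow 8)).const_mul (120 : ℝ))).add
      (((hA.pow 5).mul (hu.pow 8)).const_mul ((-26740) : ℝ))).add
      (((hA.pow 6).mul (hu.pow 9)).const_mul (1806 : ℝ))).add
      (((hA.pow 5).mul (hu.pow 9)).const_mul ((-181638) : ℝ))).add
      (((hA.pow 7).mul (hu.pow 10)).const_mul ((-19) : ℝ))).add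
      (((hA.pow 6).mul (hu.pow 10)).const_mul (18452 : ℝ))).add
      (((hA.pow 7).mul (hu.pow 11)).const_mul ((-562) : ℝ))).add
      (((hA.pow 6).mul (hu.pow 11)).const_mul (160146 : ℝ))).add
      ((hA.pow 8).mul (hu.pow 12))).add
      (((hA.pow 7).mul (hu.pow 12)).const_mul ((-8638) : ℝ))).add
      (((hA.pow 8).mul (hu.pow 13)).const_mul (97 : ℝ))).add
      (((hA.pow 7).mul (hu.pow 13)).const_mul ((-101244) : ℝ))).add
      (((hA.pow 8).mul (hu.pow 14)).const_mul (2639 : ℝ))).add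
      (((hA.pow 9).mul (hu.pow 15)).const_mul ((-7) : ℝ))).add
      (((hA.pow 8).mul (hu.pow 15)).const_mul (45378 : ℝ))).add
      (((hA.pow 9).mul (hu.pow 16)).const_mul ((-484) : ℝ))).add
      (((hA.pow 9).mul (hu.pow 17)).const_mul ((-13997) : ℝ))).add
      (((hA.pow 10).mul (hu.pow 18)).const_mul (44 : ℝ))).add
      (((hA.pow 10).mul (hu.pow 19)).const_mul (2803 : ℝ))).add
      (((hA.pow 11).mul (hu.pow 20)).const_mul ((-1) : ℝ))).add
      (((hA.pow 11).mul (hu.pow 21)).const_mul ((-324) : ℝ))).add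
      (((hA.pow 12).mul (hu.pow 23)).const_mul (16 : ℝ)))
  have h := h0.add hN
  refine Tendsto.congr' ?_ (tendsto_of_tendsto_of_eq_ti h (by ring))
  filter_upwards [eventually_gt_atTop (0 : ℝ)] with y hy
  have hw : wallRate y ≠ 0 := (wallRate_pos y).ne'
  have hy' : y ≠ 0 := hy.ne'
  field_simp
  ring

/-! ### §6  THE TENTH COEFFICIENT IS THE DIAGONAL-TEN CENSUS MINUS 2155 -/

open Classical in
/-- ★★★ **THE TENTH-ORDER CENSUS IDENTITY.**  As `y → ∞`,
`y⁹ (β(y)² − y − 1/y − 1/y² − 2/y³ − 4/y⁴ − 6/y⁵ − 12/y⁶ − 18/y⁷ − 15/y⁸) → N₁₁,₁ + N₁₂,₂ + N₁₃,₃ + N₁₄,₄ + N₁₅,₅ − 2155`,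
the five class numbers of the diagonal `s − v = 10` of the wall-renewal census (symbolic lengths `m₁ = 22, …, m₅ = 30`).  With the data `738 / 860 / 468 / 95 / 1` it is `a₉ = 7`.
[cite: Kesten1963SAW, Section 4] [cite: MadrasSlade1993, Section 4.2, (4.2.4), Theorem 4.2.2 (pp. 91–92)] [cite: BeatonBousquetMelouDeGierDuminilCopinGuttmann2014, Section 3.1, Proposition 5 (arXiv v5 p. 9); p. 10] -/
theorem tendsto_pow_nine_mul_wallRate_sq_sub_census {m₁ m₂ m₃ m₄ m₅ : ℕ} (h₁ : m₁ = 22) (h₂ : m₂ = 24) (h₃ : m₃ = 26) (h₄ : m₄ = 28) (h₅ : m₅ = 30) :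
    Tendsto (fun y : ℝ => y ^ 9 * (wallRate y ^ 2 - y - 1 / y - 1 / y ^ 2 - 2 / y ^ 3 - 4 / y ^ 4 - 6 / y ^ 5 - 12 / y ^ 6 - 18 / y ^ 7 - 15 / y ^ 8)) atTop
      (𝓝 ((#((ipwb m₁).filter fun ω => visits m₁ ω = 1) : ℝ) + #((ipwb m₂).filter fun ω => visits m₂ ω = 2) +
        #((ipwb m₃).filter fun ω => visits m₃ ω = 3) + #((ipwb m₄).filter fun ω => visits m₄ ω = 4) + #((ipwb m₅).filter fun ω => visits m₅ ω = 5) - 2155)) := by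
  have hlo := tendsto_tenth_order_comparison m₁ m₂ m₃ m₄ m₅
  have hup := hlo.add tendsto_pow_nine_mul_sq_wallRate_mul_tail_ten
  rw [add_zero] at hup
  refine tendsto_of_tendsto_of_tendsto_of_le_of_le' hlo hup ?_ ?_
  · filter_upwards [eventually_gt_atTop (hexConnectiveConstant ^ 3)] with y hy using (tenth_order_two_sided_of_cube_lt h₁ h₂ h₃ h₄ h₅ hy).1
  · filter_upwards [eventually_gt_atTop (hexConnectiveConstant ^ 3)] with y hy using (tenth_order_two_sided_of_cube_lt h₁ h₂ h₃ h₄ h₅ hy).2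

open Classical in
/-- ★★ Uniqueness form: any limit of `y⁹(β(y)² − y − … − 15/y⁸)` IS the census expression. [cite: MadrasSlade1993, Section 4.2, Theorem 4.2.2 (pp. 91–92)] -/
theorem eq_census_of_tendsto_pow_nine_mul_wallRate_sq_sub {m₁ m₂ m₃ m₄ m₅ : ℕ} (h₁ : m₁ = 22) (h₂ : m₂ = 24) (h₃ : m₃ = 26) (h₄ : m₄ = 28) (h₅ : m₅ = 30)
    {L : ℝ} (h : Tendsto (fun y : ℝ => y ^ 9 * (wallRate y ^ 2 - y - 1 / y - 1 / y ^ 2 - 2 / y ^ 3 - 4 / y ^ 4 - 6 / y ^ 5 - 12 / y ^ 6 - 18 / y ^ 7 - 15 / y ^ 8)) atTop (𝓝 L)) :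
    L = ((#((ipwb m₁).filter fun ω => visits m₁ ω = 1) : ℝ) + #((ipwb m₂).filter fun ω => visits m₂ ω = 2) +
        #((ipwb m₃).filter fun ω => visits m₃ ω = 3) + #((ipwb m₄).filter fun ω => visits m₄ ω = 4) + #((ipwb m₅).filter fun ω => visits m₅ ω = 5) - 2155) :=
  tendsto_nhds_unique h (tendsto_pow_nine_mul_wallRate_sq_sub_census h₁ h₂ h₃ h₄ h₅)

end Literature.Probability.RandomPlanarGeometry.SAW.HexBW.Wall

end
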